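import Summits.Ventures.CertifiedManyBodySolver.Downfold.UPinnedPairRowKernelCertsRows
import Summits.Ventures.CertifiedManyBodySolver.Theorems.CovHg1201M19P10LeftEdgeOfKernelPairs
import HarnessLib
import HarnessLib.Audit

/-!
# Ventures/CertifiedManyBodySolver — Theorems/CovHg1201M19P10LeftEdgeOfKernelCertsRows.lean: «PatchLeftEdgeP10» (stmt-Ventures-27104, HgBa₂CuO₄₊δ «Hg-1201»
# @10 GPa, n = 22/25 column (route `CovHg1201M19P10`)) FROM THREE KERNEL CERTIFICATES IN THE «ROWS + HALVING» DESIGN OF RECORD ON THE BOX GEOMETRY — the instance-facing tier-P closer of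
# the two left-edge U-cells (the U-AXIS twin of hubbard-cov-hg1201-box-2 g4's `…_PatchBottom*_of_kernelCertsRows`, p686635 / p686651 / p686662)

HONEST FRAMING: ONE theorem. Its hypotheses are of three kinds ONLY: (a) exporter DATA for the three vertices {P = hub at `U = 3`, Q = spoke at `U = b`
(`3 < b`, `b < 17 / 2`), W = spoke at `U = 17 / 2`} at `t′ = -49 / 100`, solve density `n₀ = 22 / 25`, objective `−X₀(-49 / 100; Uo)` at all three, in
hubbard-cov-la214-plan-1's «(N)-BY-ROWS + ADJOINT HALVING» design of record R-g4-5 (hubbard-obs STATUS 2026-08-29T01:07:34Z) on hubbard-obs-p2's box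
geometry `BoxGeom.boxQuot r R vmax` (`7 ≤ R`, `r + 1 ≤ R`, `r + vmax ≤ R`; ONE `Bkey`; ONE shared eom word list `EB`; per vertex
`TH hH TE hE TX hX μ ν κ cap κ′ fl K blocks CW hcw AV ns M Cs hC0 Hs hchain hβ hsl` — the `stepEQA` chain check `ChainQAOK …` and the ONE inequality
`β_v ≤ lowerConst (decPoly …) + (μ_v 0 + μ_v 1)(22 / 25/2 − ν_v)` are the `decide`-class kernel facts an instance carries); (b) `norm_num`-class literal
checks — the cell hypotheses of hubbard-cov-hg1201-box-2 g3's `covHg1201M19P10_PatchLeftEdgeP10_of_kernelTriple` (p682397) VERBATIM: multiplier signs, cut floors, cell 1 = {P, Q}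
re-priced to the @10 top HF plane `−15830689/10⁷ + U·121/625` values, cell 2 = {Q, W} re-priced to a polarised constant `c`, the DOCC-BOX law's `L` (docc box `[0, 1/4]`), the floor
kinds, three strip prices per cell against bar `4767609/10⁷`; (c) nothing else. NO claim node, NO `@[conjecture]`, NO number of record is used or moved;
NOTHING is evaluated or instantiated here (no Hg-1201 exporter output exists — kit-side, not ordered; the (β0)/(β2) tier-P probes of 2026-08-29 are
INSTRUMENT class and «no Lean proposal comes out of (β2)», captain hubbard-cov-hg1201-plan-1 2026-08-29T00:33:51Z); TARGETS in the design of record AS OF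
2026-08-29 — not re-cut by this programme if the design revs (captain 2026-08-29T01:28:51Z clauses (a)/(b)); the closer of record p676848 `covHg1201M19P10_PatchLeftEdgeP10_of_dext176q_nodes`, the leaf
p677463, the registry rows CTL 159–162, tiers, margins and the pen HOLD on stmt-Ventures-27104 are UNCHANGED; «closed modulo nodes» ≠ proved; no summit
statement is proved by this file. ZERO compute, no definition, no `sorry`.

THE CHAIN (every link a tree theorem, BY NAME): exporter data ×3 → this seat's `SquareTTPrimePinnedPairRowU.of_quotAdjChainKernelCertsTBRowsHalfAuto_box`
(`Downfold/UPinnedPairRowKernelCertsRows.lean`, FILE A §2: geometry, PSD-ness of the two-level Gram coefficients, the anti-Hermitian remainder and the eom far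
check discharged THERE; through hubbard-obs-p2's `Rows/CARPolyWindowGramTBRows.lean` / `…CorrWindowCertKernelEomAuto.lean`, hubbard-cov-la214-unc-2's chain /
quotient kernels and hubbard-cov-hg1201-box-2 g3's `SquareTTPrimePinnedPairRowU.of_residPolys_wide` p680519) on the pairs {P, Q} and {Q, W} ⇒ two pinned
U-pair SHAPES `SquareTTPrimePinnedPairRowU …` (hubbard-cov-hg1201-box-1 p660744) → `.reprice` / `.mono` → hubbard-cov-hg1201-box-2 g3's
`covHg1201M19P10_PatchLeftEdgeP10_of_pairU_twoCells` (p682397) ⇒ `Theses.CovHg1201M19P10.PatchLeftEdgeP10`.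

Cell `hubbard-obs` (D-0154 (1)(C) Hg-1201), seat hubbard-cov-hg1201-box-1 g4 (`prover-hubbard-cov-hg1201-box-1-g4-0`), U-direction / lineage desk;
wording class (xx1): CONTROL / CALIBRATION one-sided stiffness-scale ceilings of a downfolded screening-grade one-band box; a ceiling never speaks to the
presence of superconductivity or to `ρ_s = 0`; not a `T_c` / phase / pressure sentence (the @0 / @10 columns are certified separately); nothing about
HgBa₂CuO₄₊δ samples.

References: X. Han, arXiv:2006.06002 §3 [Han2020Bootstrap]; J. Wang et al., PRX 14 (2024) 031006 §III [WangEtAl2024]; C. Jansson, D. Chaykin, C. Keil,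
SIAM J. Numer. Anal. 46 (2008) 180 §3 [JanssonChaykinKeil2008]; T. Koma, H. Tasaki, J. Stat. Phys. 76 (1994) 745 §1 [KomaTasaki1994]; S. Boyd,
L. Vandenberghe, *Convex Optimization* (2004) §5.9 [BoydVandenberghe2004]; D. J. Scalapino, S. R. White, S.-C. Zhang, PRB 47 (1993) 7995 §II
[ScalapinoWhiteZhang1993].
-/

noncomputable section

namespace Summit.Ventures.CertifiedManyBodySolver.Theorems

open Summit.Ventures.CertifiedManyBodySolver.Theses.CovHg1201M19P10 (PatchLeftEdgeP10)
open Summit.Ventures.CertifiedManyBodySolver.Downfold Summit.Ventures.CertifiedManyBodySolver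
open Summit.Ventures.CertifiedManyBodySolver.Observables
open Summit.Ventures.CertifiedQuantumChemistry Summit.Ventures.CertifiedQuantumChemistry.CARPoly
open Summit.Ventures.CertifiedManyBodySolver.CARPolyWindow Summit.Ventures.CertifiedManyBodySolver.CARPolyWindow.BoxGeom
open Literature.MathematicalPhysics.QuantumManyBody.StateRelaxation
open Literature.MathematicalPhysics.QuantumLattice Literature.MathematicalPhysics.QuantumLattice.ThermodynamicLimit
open Literature.Probability.LatticeModels
open Matrix Filter Topology HubbardWave0
open scoped BigOperators ComplexOrder

/-- **«PatchLeftEdgeP10» (stmt-Ventures-27104) FROM THREE KERNEL CERTIFICATES IN THE «ROWS + HALVING» DESIGN OF RECORD ON THE BOX GEOMETRY `boxQuot r R vmax`** —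
vertices {P hub `U = 3`, Q spoke `U = b`, W spoke `U = 17 / 2`} at `t′ = -49 / 100`, `n₀ = 22 / 25`, ONE `Bkey`, ONE shared `EB`, objective
`Γ(incl)(−oddMomentObsTT (-49 / 100) Uo 0)` at all three; per vertex the instance supplies `TH hH TE hE TX hX μ ν κ cap κ′ fl K blocks CW hcw AV ns M Cs hC0 Hs
hchain hβ hsl` only; then the literal cell checks of `covHg1201M19P10_PatchLeftEdgeP10_of_kernelTriple` (cell 1 = {P, Q} on the plane, cell 2 = {Q, W} at the
constant `c`; DOCC-BOX law, floor kinds, strip prices). Conclusion: the route decl — NO claim node; nothing instantiated in this file.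
[cite: Han2020Bootstrap, §3] [cite: WangEtAl2024, §III] [cite: JanssonChaykinKeil2008, §3] [cite: KomaTasaki1994, §1] [cite: BoydVandenberghe2004, §5.9] -/
theorem covHg1201M19P10_PatchLeftEdgeP10_of_kernelCertsRowsTriple
    (b : ℚ) (hb₁ : 3 < b) (hb₂ : b < 17 / 2) (Uo : ℝ)
    (r R vmax : ℕ) (h7R : 7 ≤ R) (hrR : r + 1 ≤ R) (hvR : r + vmax ≤ R) (Bkey : ℕ)
    -- the SHARED eom words (inner window letters)
    (EB : List (Terms (Orb (Fin (boxN r)))))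
    -- vertex P (hub, `U = 3`): the design-of-record residue on the box geometry
    (THP : Terms (Orb (Fin (boxN R))))
    (hHP : termOp (boxD R) THP =
      (hubbardTTPrimeFermionInteraction 1 (((-49 / 100 : ℚ)) : ℝ) (((3 : ℚ)) : ℝ)).localHamiltonian (boxW R))
    (TEP : Terms (Orb (Fin (boxN R))))
    (hEP : termOp (boxD R) TEP =
      fermionEmbed (PolySite.incl (thicken01_subset_boxW (le_trans (by norm_num) h7R)))
        ((hubbardTTPrimeFermionInteraction 1 (((-49 / 100 : ℚ)) : ℝ) (((3 : ℚ)) : ℝ)).meanEnergyObs 1))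
    (TXP : Terms (Orb (Fin (boxN R))))
    (hXP : termOp (boxD R) TXP = fermionEmbed (PolySite.incl (box_subset_boxW h7R)) (-oddMomentObsTT (-49 / 100) Uo 0))
    (μP : Fin 2 → ℚ) (νP κP capP κP' flP : ℚ) (KP : ℕ) (blocksP : List (List (List ℤ × Terms (Orb (Fin (boxN R))))))
    (CWP : Terms (Orb (Fin (boxN R)))) (hcwP : ∀ wc ∈ CWP, chargeW wc.1 ≠ 0 ∨ spinChargeW (fun a => (ofLex a).2) wc.1 ≠ 0)
    (AVP : List (Terms (Orb (Fin (boxN R)))))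
    (nsP : List ℕ) (MP : ℕ) (CsP : List SOSDual.EncPoly) (hC0P : CsP.getD 0 [] = []) (HsP : List (List (QHint (boxN r))))
    (hchainP : ChainQAOK (boxQuot r R vmax) Bkey MP CsP
      (groupSlices (residTGslicesNear TXP μP νP (fun σ => orb (boxIx R 0) σ) κP capP κP' flP TEP (gramTBRowsHalf KP blocksP) THP (boxPush r R) EB
        (autoMasks THP (boxPush r R) EB) (fun l : Fin 0 => l.elim0) (fun l : Fin 0 => l.elim0) CWP AVP) nsP) HsP)
    {βP : ℚ}
    (hβP : haveI := neZero_boxN R; βP ≤ lowerConst (SOSDual.decPoly (boxN R) (CsP.getD MP [])) + (μP 0 + μP 1) * ((22 / 25 : ℚ) / 2 - νP))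
    {slP : ℚ} (hslP : slP = (μP 0 + μP 1) / 2)
    -- vertex Q (spoke, `U = b`): the design-of-record residue on the box geometry
    (THQ : Terms (Orb (Fin (boxN R))))
    (hHQ : termOp (boxD R) THQ =
      (hubbardTTPrimeFermionInteraction 1 (((-49 / 100 : ℚ)) : ℝ) ((b : ℚ) : ℝ)).localHamiltonian (boxW R))
    (TEQ : Terms (Orb (Fin (boxN R))))
    (hEQ : termOp (boxD R) TEQ =
      fermionEmbed (PolySite.incl (thicken01_subset_boxW (le_trans (by norm_num) h7R)))
        ((hubbardTTPrimeFermionInteraction 1 (((-49 / 100 : ℚ)) : ℝ) ((b : ℚ) : ℝ)).meanEnergyObs 1))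
    (TXQ : Terms (Orb (Fin (boxN R))))
    (hXQ : termOp (boxD R) TXQ = fermionEmbed (PolySite.incl (box_subset_boxW h7R)) (-oddMomentObsTT (-49 / 100) Uo 0))
    (μQ : Fin 2 → ℚ) (νQ κQ capQ κQ' flQ : ℚ) (KQ : ℕ) (blocksQ : List (List (List ℤ × Terms (Orb (Fin (boxN R))))))
    (CWQ : Terms (Orb (Fin (boxN R)))) (hcwQ : ∀ wc ∈ CWQ, chargeW wc.1 ≠ 0 ∨ spinChargeW (fun a => (ofLex a).2) wc.1 ≠ 0)
    (AVQ : List (Terms (Orb (Fin (boxN R)))))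
    (nsQ : List ℕ) (MQ : ℕ) (CsQ : List SOSDual.EncPoly) (hC0Q : CsQ.getD 0 [] = []) (HsQ : List (List (QHint (boxN r))))
    (hchainQ : ChainQAOK (boxQuot r R vmax) Bkey MQ CsQ
      (groupSlices (residTGslicesNear TXQ μQ νQ (fun σ => orb (boxIx R 0) σ) κQ capQ κQ' flQ TEQ (gramTBRowsHalf KQ blocksQ) THQ (boxPush r R) EB
        (autoMasks THQ (boxPush r R) EB) (fun l : Fin 0 => l.elim0) (fun l : Fin 0 => l.elim0) CWQ AVQ) nsQ) HsQ)
    {βQ : ℚ}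
    (hβQ : haveI := neZero_boxN R; βQ ≤ lowerConst (SOSDual.decPoly (boxN R) (CsQ.getD MQ [])) + (μQ 0 + μQ 1) * ((22 / 25 : ℚ) / 2 - νQ))
    {slQ : ℚ} (hslQ : slQ = (μQ 0 + μQ 1) / 2)
    -- vertex W (spoke, `U = 17 / 2`): the design-of-record residue on the box geometry
    (THW : Terms (Orb (Fin (boxN R))))
    (hHW : termOp (boxD R) THW =
      (hubbardTTPrimeFermionInteraction 1 (((-49 / 100 : ℚ)) : ℝ) (((17 / 2 : ℚ)) : ℝ)).localHamiltonian (boxW R))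
    (TEW : Terms (Orb (Fin (boxN R))))
    (hEW : termOp (boxD R) TEW =
      fermionEmbed (PolySite.incl (thicken01_subset_boxW (le_trans (by norm_num) h7R)))
        ((hubbardTTPrimeFermionInteraction 1 (((-49 / 100 : ℚ)) : ℝ) (((17 / 2 : ℚ)) : ℝ)).meanEnergyObs 1))
    (TXW : Terms (Orb (Fin (boxN R))))
    (hXW : termOp (boxD R) TXW = fermionEmbed (PolySite.incl (box_subset_boxW h7R)) (-oddMomentObsTT (-49 / 100) Uo 0))
    (μW : Fin 2 → ℚ) (νW κW capW κW' flW : ℚ) (KW : ℕ) (blocksW : List (List (List ℤ × Terms (Orb (Fin (boxN R))))))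
    (CWW : Terms (Orb (Fin (boxN R)))) (hcwW : ∀ wc ∈ CWW, chargeW wc.1 ≠ 0 ∨ spinChargeW (fun a => (ofLex a).2) wc.1 ≠ 0)
    (AVW : List (Terms (Orb (Fin (boxN R)))))
    (nsW : List ℕ) (MW : ℕ) (CsW : List SOSDual.EncPoly) (hC0W : CsW.getD 0 [] = []) (HsW : List (List (QHint (boxN r))))
    (hchainW : ChainQAOK (boxQuot r R vmax) Bkey MW CsW
      (groupSlices (residTGslicesNear TXW μW νW (fun σ => orb (boxIx R 0) σ) κW capW κW' flW TEW (gramTBRowsHalf KW blocksW) THW (boxPush r R) EB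
        (autoMasks THW (boxPush r R) EB) (fun l : Fin 0 => l.elim0) (fun l : Fin 0 => l.elim0) CWW AVW) nsW) HsW)
    {βW : ℚ}
    (hβW : haveI := neZero_boxN R; βW ≤ lowerConst (SOSDual.decPoly (boxN R) (CsW.getD MW [])) + (μW 0 + μW 1) * ((22 / 25 : ℚ) / 2 - νW))
    {slW : ℚ} (hslW : slW = (μW 0 + μW 1) / 2)
    -- multiplier signs and cut floors
    (hκP : 0 ≤ κP) (hκP' : 0 ≤ κP') (hκQ : 0 ≤ κQ) (hκQ' : 0 ≤ κQ') (hκW : 0 ≤ κW) (hκW' : 0 ≤ κW')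
    (hflP : flP ≤ -124827703/50000000) (hflQ : flQ ≤ -124827703/50000000) (hflW : flW ≤ -124827703/50000000)
    -- cell 1 = {P, Q} re-priced to the top-plane values `cP♯`, `cQ♯`: bounds, law, slot, prices
    {cPs cQs βPs βQs F₁ L₁ : ℚ}
    (hcPs : cPs = -15830689/10000000 + 3 * (121/625)) (hcQs : cQs = -15830689/10000000 + b * (121/625))
    (hβPs : βPs ≤ βP - κP * (cPs - capP)) (hβQs : βQs ≤ βQ - κQ * (cQs - capQ))
    (hL₁ : ((L₁ : ℚ) : ℝ) = (((b : ℚ) : ℝ) - 3) * max ((((κQ - κP) - (κQ' - κP') : ℚ) : ℝ) * 0)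
        ((((κQ - κP) - (κQ' - κP') : ℚ) : ℝ) * (((1 / 4 : ℚ)) : ℝ)) -
          ((((κQ - κP) * (cQs - cPs) + (κQ' - κP') * (-(flQ - flP)) : ℚ)) : ℝ))
    (hF₁v : L₁ ≤ 0 → F₁ ≤ min βPs βQs)
    (hF₁i : 0 < L₁ → ((F₁ : ℚ) : ℝ) ≤ ((βPs : ℚ) : ℝ) - (((L₁ : ℚ) : ℝ) - (((βQs : ℚ) : ℝ) - ((βPs : ℚ) : ℝ))) ^ 2 / (4 * ((L₁ : ℚ) : ℝ)))
    (p₀ : -F₁ ≤ 4767609 / 10000000) (p₁ : -F₁ - slP * (43 / 50 - 22 / 25) ≤ 4767609 / 10000000)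
    (p₂ : -F₁ - slQ * (43 / 50 - 22 / 25) ≤ 4767609 / 10000000)
    -- cell 2 = {Q, W} re-priced to the polarised constant `c`: bounds, law, slot, prices
    {c βQc βWc F₂ L₂ : ℚ} (hc₁ : (-6148940299/10000000000 : ℚ) ≤ c) (hc₂ : (-5511249107/10000000000 : ℚ) ≤ c)
    (hcU : ((c : ℚ) : ℝ) + 15861979 / 10000000 ≤ ((b : ℚ) : ℝ) / 4)
    (hβQc : βQc ≤ βQ - κQ * (c - capQ)) (hβWc : βWc ≤ βW - κW * (c - capW))
    (hL₂ : ((L₂ : ℚ) : ℝ) = (17 / 2 - ((b : ℚ) : ℝ)) * max ((((κW - κQ) - (κW' - κQ') : ℚ) : ℝ) * 0)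
        ((((κW - κQ) - (κW' - κQ') : ℚ) : ℝ) * (((1 / 4 : ℚ)) : ℝ)) -
          ((((κW - κQ) * (c - c) + (κW' - κQ') * (-(flW - flQ)) : ℚ)) : ℝ))
    (hF₂v : L₂ ≤ 0 → F₂ ≤ min βQc βWc)
    (hF₂i : 0 < L₂ → ((F₂ : ℚ) : ℝ) ≤ ((βQc : ℚ) : ℝ) - (((L₂ : ℚ) : ℝ) - (((βWc : ℚ) : ℝ) - ((βQc : ℚ) : ℝ))) ^ 2 / (4 * ((L₂ : ℚ) : ℝ)))
    (q₀ : -F₂ ≤ 4767609 / 10000000) (q₁ : -F₂ - slQ * (43 / 50 - 22 / 25) ≤ 4767609 / 10000000)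
    (q₂ : -F₂ - slW * (43 / 50 - 22 / 25) ≤ 4767609 / 10000000) :
    PatchLeftEdgeP10 := by
  -- (1) the two pinned U-pair shapes from the box certificates (FILE A §2; shared `EB`, one `Bkey`; the middle vertex `Q` serves both pairs),
  --     re-priced to the cells' caps exactly as in `covHg1201M19P10_PatchLeftEdgeP10_of_kernelTriple`
  have hPQ := ((SquareTTPrimePinnedPairRowU.of_quotAdjChainKernelCertsTBRowsHalfAuto_box r R vmax h7R hrR hvR (3) (by norm_num) b (-49 / 100) (22 / 25)
    Bkey (-oddMomentObsTT (-49 / 100) Uo 0) EB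
    THP hHP TEP hEP TXP hXP μP νP κP capP κP' flP KP blocksP CWP hcwP AVP nsP MP CsP hC0P HsP hchainP hβP hslP
    THQ hHQ TEQ hEQ TXQ hXQ μQ νQ κQ capQ κQ' flQ KQ blocksQ CWQ hcwQ AVQ nsQ MQ CsQ hC0Q HsQ hchainQ hβQ hslQ).reprice cPs cQs).mono
    hβPs hβQs
  have hQW := ((SquareTTPrimePinnedPairRowU.of_quotAdjChainKernelCertsTBRowsHalfAuto_box r R vmax h7R hrR hvR b (by linarith) (17 / 2) (-49 / 100) (22 / 25)
    Bkey (-oddMomentObsTT (-49 / 100) Uo 0) EB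
    THQ hHQ TEQ hEQ TXQ hXQ μQ νQ κQ capQ κQ' flQ KQ blocksQ CWQ hcwQ AVQ nsQ MQ CsQ hC0Q HsQ hchainQ hβQ hslQ
    THW hHW TEW hEW TXW hXW μW νW κW capW κW' flW KW blocksW CWW hcwW AVW nsW MW CsW hC0W HsW hchainW hβW hslW).reprice c c).mono
    hβQc hβWc
  -- (2) numerals
  have e1 : (((3 : ℚ)) : ℝ) = 3 := by norm_num
  have e2 : (((17 / 2 : ℚ)) : ℝ) = 17 / 2 := by norm_num
  have e3 : (((-49 / 100 : ℚ)) : ℝ) = -49 / 100 := by norm_num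
  rw [e1, e3] at hPQ
  rw [e2, e3] at hQW
  have hb₁' : (((3 : ℚ)) : ℝ) < ((b : ℚ) : ℝ) := Rat.cast_lt.2 hb₁
  have hb₂' : ((b : ℚ) : ℝ) < (((17 / 2 : ℚ)) : ℝ) := Rat.cast_lt.2 hb₂
  rw [e1] at hb₁'
  rw [e2] at hb₂'
  -- (3) the re-priced caps of cell 1 lie ON the top plane
  have hcP : ((-15830689/10000000 : ℚ) : ℝ) + (3 : ℝ) * ((121/625 : ℚ) : ℝ) ≤ ((cPs : ℚ) : ℝ) := by
    rw [hcPs]; push_cast; linarith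
  have hcQ : ((-15830689/10000000 : ℚ) : ℝ) + ((b : ℚ) : ℝ) * ((121/625 : ℚ) : ℝ) ≤ ((cQs : ℚ) : ℝ) := by
    rw [hcQs]; push_cast; linarith
  -- (4) the item from the two cells
  exact covHg1201M19P10_PatchLeftEdgeP10_of_pairU_twoCells hb₁' hb₂' Uo Uo hPQ hκP hκP' hκQ hκQ' hcP hcQ hflP hflQ hL₁ hF₁v hF₁i p₀ p₁ p₂
    hc₁ hc₂ hcU hQW hκQ hκQ' hκW hκW' hflQ hflW hL₂ hF₂v hF₂i q₀ q₁ q₂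

end Summit.Ventures.CertifiedManyBodySolver.Theorems

end
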